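import Literature.AnabelianGeometry.EtaleTheta.Discharge.Sec5Prop53Coordinates
import Literature.AnabelianGeometry.EtaleTheta.Discharge.Sec5Prop53LabelsOrders
import Literature.AnabelianGeometry.EtaleTheta.Discharge.Sec5Prop53ThetaOrbitOrders

/-!
# [EtTh] §5, Proposition 5.3, all six parts, over ORDER COORDINATES: a NON-VACUOUS instance form of the conjunction
# `GeometryOfDivisorsPreserved` (row F-2497) — no "monoid type `ℤ`" structure, valid at PERFECT `Φ(A_⊚)`

Mochizuki, *The étale theta function and its Frobenioid-theoretic manifestations*, Publ. RIMS **45** (2009), §5, Prop. 5.3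
(i)–(vi), pp. 325–326 (PDF pp. 99–100), proof pp. 326–327 (PDF pp. 100–101) [cite: MochizukiEtTh2009, Prop 5.3 p.325 (PDF
p.99)]; Prop. 3.2 (i) p. 296 (PDF p. 70); Prop. 5.1 p. 323 (PDF p. 97) (`Φ(−)` PERFECT).  Cell abc-iut, block F, seat abc-iut-f-128
(tranche 128, row F-2497 `GeometryOfDivisorsPreserved`).  PROOF-ONLY assembly (no `def`, no instance, nothing landed is edited)
over this seat's `Sec5Prop53Coordinates.lean` (p436610: (ii), (iii)), `Sec5Prop53LabelsOrders.lean` (p438690: (v)) and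
`Sec5Prop53ThetaOrbitOrders.lean` (p437011: (vi)), and abc-iut-L2-d4's `cuspPreserved_of_elements` ((i), primes from elements).

WHY.  The instance form OF RECORD of F-2497, abc-iut-L6-d1's `geometryOfDivisorsPreserved_of_supportData' (𝔖 : DivisorSupportData' 𝔓)`,
is VACUOUS at every §5 datum with perfect `Φ(A_⊚)` (abc-iut-f-127, `isEmpty_divisorSupportData'_of_isPerfect`, p434934).  Its
twin here, **`geometryOfDivisorsPreserved_of_orders`**, takes instead ONE product-valued factorization
`factor : Φ(A_⊚) → ∏_𝔭 ℚ` (Prop. 3.2 (i); at a perfect datum the `ℚ_{≥0}`-coefficients) and, as explicit binders, exactly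
what the printed proof uses: `Ψ^Φ_{A_⊚}` carries the orders along (`hψo`; [FrdI] Thm. 4.9 / Cor. 3.8 (iii)), the natural
isomorphisms of (ii)/(iii) are pinned by the orders (`hisoN`, `hisoC`: "identifying the elements … that arise from prime
log-divisors"), the orders are injective on each primary component (`hφ`) and separate `Φ(A_⊚)^gp` (`hsep`), the principal
elements `P` are preserved (`hP`, F1-Ψ), the printed adjacency criterion (`hAdj`, p.326–327), the profile of `div(Θ̈)`
(`hdiv`, `hcusp`; Prop. 1.4 (i)), the action of `Aut_C(A_⊚)` on the chain (`hAutO`, `hAut`, `htrans`; §1), and clause (iv)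
itself (`hiv` — its order-coordinate derivation from the p.326 description of `Prime^csp ↠ Prime^ncsp` is the business of row
F-0560).  The element-level clause (i) is the typed `PreservesCuspidality` (`hi`), as in the form of record.

HONEST FRAMING: kernel-checked implication about the TYPED data; every binder records an input of print and is asserted
nowhere; typed ≠ proved; no side taken on [IUTchIII] Cor. 3.12 or on any author.
-/

namespace Literature.AnabelianGeometry.EtaleTheta

open CategoryTheory
open Literature.AlgebraicGeometry.Frobenioids

universe w v v' u u'

namespace FrobenioidThetaDivisors

variable {C : Type u} [Category.{v} C] {D : Type u'} [Category.{v'} D] {𝔉 : ThetaFrobenioid.{w} C D}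
  {𝔓 : DivisorPrimeData 𝔉} (Ψ : C ≌ C) (ι : Ψ.functor.obj 𝔉.Acirc ≅ 𝔉.Acirc)
  (e : 𝔉.PhiAcirc ≃* 𝔉.pre.Mon (𝔉.base.obj (Ψ.functor.obj 𝔉.Acirc)))

/-- Transport of the `Φ^gp`-orders in the shape used by (vi): `ord_𝔮(φ^gp x) = ord_{φ⁻¹𝔮}(x)`, from the `Φ`-level transport
`ord_{φ𝔭}(φ a) = ord_𝔭(a)`. [cite: MochizukiEtTh2009, Prop 5.3 proof p.326 (PDF p.100)] -/
theorem toAdd_ordGpOf'_gpMap_of_ordMap (factor : 𝔉.PhiAcirc →* (Primes 𝔉.PhiAcirc → Multiplicative ℚ))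
    (φ : 𝔉.PhiAcirc ≃* 𝔉.PhiAcirc)
    (hφo : ∀ (𝔭 : Primes 𝔉.PhiAcirc) (a : 𝔉.PhiAcirc), ordOf' factor (Primes.congr φ 𝔭) (φ a) = ordOf' factor 𝔭 a)
    (𝔮 : Primes 𝔉.PhiAcirc) (x : Algebra.GrothendieckGroup 𝔉.PhiAcirc) :
    Multiplicative.toAdd (ordGpOf' factor 𝔮 (ThetaFrobenioid.gpMap (φ : 𝔉.PhiAcirc →* 𝔉.PhiAcirc) x)) =
      Multiplicative.toAdd (ordGpOf' factor (Primes.congr φ.symm 𝔮) x) := by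
  rw [← MulEquiv.toMonoidHom_eq_coe, ← ordGpOf'_gpMap_of_ordMap factor φ hφo (Primes.congr φ.symm 𝔮) x,
    Primes.congr_apply_congr_symm]

/-- **[EtTh] Prop. 5.3, all six parts, NON-VACUOUS INSTANCE FORM over order coordinates (row F-2497)** — the conjunction
`GeometryOfDivisorsPreserved T 𝔓 Ψ ι e` from the `Ψ`-induced `e` (`hind`), (i) as typed (`hi`), ONE product-valued factorization
`factor` with: orders carried along by `Ψ^Φ_{A_⊚}` (`hψo`) and by `Aut_C(A_⊚)` (`hAutO`), injective on each primary component
(`hφ`) and separating `Φ(A_⊚)^gp` (`hsep`), natural isomorphisms pinned by the orders (`hisoN`, `hisoC`), principal elements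
preserved (`hP`), the printed adjacency criterion (`hAdj`), the profile of `div(Θ̈)` (`hdiv`, `hcusp`), the action of `Aut_C(A_⊚)`
on the chain (`hAut`, `htrans`), and clause (iv) (`hiv`).  Twin of abc-iut-L6-d1's `geometryOfDivisorsPreserved_of_supportData'`
without the `ℤ_{≥0}`-structure that is uninhabited at perfect `Φ(A_⊚)`.
[cite: MochizukiEtTh2009, Prop 5.3 p.325–326 (PDF pp.99–100); proof p.326–327 (PDF pp.100–101)] -/
theorem geometryOfDivisorsPreserved_of_orders (T : DivisorTransportStub 𝔉) (hind : T.IsInducedBy Ψ 𝔉.Acirc e)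
    (hi : PreservesCuspidality T 𝔓 Ψ ι e)
    (factor : 𝔉.PhiAcirc →* (Primes 𝔉.PhiAcirc → Multiplicative ℚ))
    (hψo : ∀ (𝔭 : Primes 𝔉.PhiAcirc) (a : 𝔉.PhiAcirc),
      ordOf' factor (Primes.congr (psiPhi 𝔉 Ψ ι e) 𝔭) (psiPhi 𝔉 Ψ ι e a) = ordOf' factor 𝔭 a)
    (hφ : ∀ 𝔭 : Primes 𝔉.PhiAcirc, Function.Injective fun x : ↥𝔭.submonoid => ordOf' factor 𝔭 x)
    (hisoN : ∀ (p q : Primes 𝔉.PhiAcirc) (hp : ¬ 𝔓.IsCuspidal p) (hq : ¬ 𝔓.IsCuspidal q) (x : ↥p.submonoid),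
      ordOf' factor q (𝔓.ncspIso p q hp hq x) = ordOf' factor p x)
    (hisoC : ∀ (p q : Primes 𝔉.PhiAcirc) (hp : 𝔓.IsCuspidal p) (hq : 𝔓.IsCuspidal q) (x : ↥p.submonoid),
      ordOf' factor q (𝔓.cspIso p q hp hq x) = ordOf' factor p x)
    (P : Subgroup (Algebra.GrothendieckGroup 𝔉.PhiAcirc))
    (hP : ∀ x, ThetaFrobenioid.gpMap (psiPhi 𝔉 Ψ ι e).toMonoidHom x ∈ P ↔ x ∈ P)
    (hAdj : ∀ (𝔭 𝔮 : Primes 𝔉.PhiAcirc) (h𝔭 : ¬ 𝔓.IsCuspidal 𝔭) (h𝔮 : ¬ 𝔓.IsCuspidal 𝔮), 𝔭 ≠ 𝔮 →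
      ∀ a : 𝔭.submonoid, (a : 𝔉.PhiAcirc) ∈ 𝔭.carrier →
        (Adjacent 𝔓 ⟨𝔭, h𝔭⟩ ⟨𝔮, h𝔮⟩ ↔
          ∀ c, IsCuspidallyMinimalOf' 𝔓 factor P c →
            LinEquivOf P c (Algebra.GrothendieckGroup.of (a : 𝔉.PhiAcirc) *
              Algebra.GrothendieckGroup.of (𝔓.ncspIso 𝔭 𝔮 h𝔭 h𝔮 a : 𝔉.PhiAcirc)) →
            (suppOf' factor c).ncard = 4))
    (hiv : PreservesCspToNcsp 𝔓 Ψ ι e (hi hind).2.2)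
    (hsep : ∀ x y : Algebra.GrothendieckGroup 𝔉.PhiAcirc,
      (∀ 𝔭, Multiplicative.toAdd (ordGpOf' factor 𝔭 x) = Multiplicative.toAdd (ordGpOf' factor 𝔭 y)) → x = y)
    (κ : ℚ) (θ : ℤ → ℚ) (s : ℤ) (hθ : ∀ j, θ (s - j) = θ j)
    (hcusp : ∀ 𝔠, 𝔓.IsCuspidal 𝔠 → Multiplicative.toAdd (ordGpOf' factor 𝔠 𝔓.divTheta) = κ)
    (hdiv : ∀ (𝔫 : Primes 𝔉.PhiAcirc) (h𝔫 : ¬ 𝔓.IsCuspidal 𝔫),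
      Multiplicative.toAdd (ordGpOf' factor 𝔫 𝔓.divTheta) = θ (𝔓.ncspEquivZ ⟨𝔫, h𝔫⟩))
    (hAutO : ∀ (g : Aut 𝔉.Acirc) (𝔭 : Primes 𝔉.PhiAcirc) (a : 𝔉.PhiAcirc),
      ordOf' factor (Primes.congr (𝔉.pullAut g) 𝔭) (𝔉.pullAut g a) = ordOf' factor 𝔭 a)
    (hAut : ∀ g : Aut 𝔉.Acirc, (∀ 𝔭, 𝔓.IsCuspidal (Primes.congr (𝔉.pullAut g) 𝔭) ↔ 𝔓.IsCuspidal 𝔭) ∧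
      ∃ (ε : ℤˣ) (c : ℤ), ∀ (𝔭 : Primes 𝔉.PhiAcirc) (h𝔭 : ¬ 𝔓.IsCuspidal 𝔭)
        (h𝔭' : ¬ 𝔓.IsCuspidal (Primes.congr (𝔉.pullAut g) 𝔭)),
        𝔓.ncspEquivZ ⟨Primes.congr (𝔉.pullAut g) 𝔭, h𝔭'⟩ = ε * 𝔓.ncspEquivZ ⟨𝔭, h𝔭⟩ + c)
    (htrans : ∀ t : ℤ, ∃ g : Aut 𝔉.Acirc,
      (∀ 𝔭, 𝔓.IsCuspidal (Primes.congr (𝔉.pullAut g) 𝔭) ↔ 𝔓.IsCuspidal 𝔭) ∧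
      ∀ (𝔭 : Primes 𝔉.PhiAcirc) (h𝔭 : ¬ 𝔓.IsCuspidal 𝔭) (h𝔭' : ¬ 𝔓.IsCuspidal (Primes.congr (𝔉.pullAut g) 𝔭)),
        𝔓.ncspEquivZ ⟨Primes.congr (𝔉.pullAut g) 𝔭, h𝔭'⟩ = 𝔓.ncspEquivZ ⟨𝔭, h𝔭⟩ + t) :
    GeometryOfDivisorsPreserved T 𝔓 Ψ ι e := by
  obtain ⟨h₁, h₂, hc⟩ := hi hind
  have hψφ : ∀ (p : Primes 𝔉.PhiAcirc) (x : ↥p.submonoid),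
      ordOf' factor _ (Primes.submonoidCongr (psiPhi 𝔉 Ψ ι e) p _ rfl x : 𝔉.PhiAcirc) = ordOf' factor p x :=
    fun p x => hψo p x
  have hii : PreservesNcspComponentIsos 𝔓 Ψ ι e hc :=
    preservesNcspComponentIsos_of_coordinates 𝔓 Ψ ι e hc (fun 𝔭 x => ordOf' factor 𝔭 x) hφ hisoN hψφ
  have hv : PreservesNcspLabels 𝔓 Ψ ι e hc :=
    preservesNcspLabels_of_orders 𝔓 Ψ ι e factor P hc hii hψo hP hAdj
  exact
    { induced := hind
      elements := ⟨h₁, h₂⟩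
      primes := hc
      ncspIsos := hii
      cspIsos := preservesCspComponentIsos_of_coordinates 𝔓 Ψ ι e hc (fun 𝔭 x => ordOf' factor 𝔭 x) hφ hisoC hψφ
      cspToNcsp := hiv
      labels := hv
      thetaOrbit := preservesThetaDivisorOrbit_of_orders 𝔓 Ψ ι e
        (fun 𝔭 x => Multiplicative.toAdd (ordGpOf' factor 𝔭 x)) hsep hc hv
        (toAdd_ordGpOf'_gpMap_of_ordMap factor _ hψo) κ θ s hθ hcusp hdiv
        (fun g => ⟨toAdd_ordGpOf'_gpMap_of_ordMap factor _ (hAutO g), hAut g⟩) htrans }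

end FrobenioidThetaDivisors

end Literature.AnabelianGeometry.EtaleTheta
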